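import Summits.AtomisticToContinuum.BoseEinsteinCondensation.Theorems.BECTangentRigidityRigidMomentumBoundSmearStepAux
import Summits.AtomisticToContinuum.BoseEinsteinCondensation.Theorems.BECTangentRigidityRigidMomentumBoundSmearStepCore
import Summits.AtomisticToContinuum.BoseEinsteinCondensation.Theorems.BECTangentRigidityRigidMomentumBoundSmearStepF
import HarnessLib

/-!
# Crux `RigidMomentumBound` (stmt-AtomisticToContinuum-13034), line `registered`:
# the smearing step, part 4 — derivative bounds for `θ = √(η² + F) - η`

Supports (does not close) stmt-AtomisticToContinuum-13034. With the calculus facts (H2) and the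
weight facts (H3) of `stub_smearStep` as hypotheses on abstract `F, w, u, w'`:

* `sq_fderiv_F_le` : `(DF(X)Y)² ≤ 4 F(X) · ∫_{(0,2τ]} |DΦ(X-t𝟙ₐ)Y|² w(t) dt` (Cauchy–Schwarz);
* `sq_fderiv_F_rigid_le` : `(DF(X)𝟙ₐ)² ≤ F(X) · ∫ |Φ(X-t𝟙ₐ)|² u(t) dt` (integration by parts moved the
  rigid derivative onto the weight, `|w'| = √w√u`, then Cauchy–Schwarz);
* `sq_fderiv_theta_le`, `sq_fderiv_theta_rigid_le` : the corresponding bounds for `θ`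
  (`(Dθ)² = (DF)²/(4(η²+F))`), and their integrals over `X` by Tonelli and translation invariance:
  `∫(DθY)² ≤ ∫|DΦ Y|²` (`lintegral_sq_fderiv_theta_le`), `∫(Dθ𝟙ₐ)² ≤ π²/(4τ²)`
  (`lintegral_sq_fderiv_theta_rigid_le`), `∫ V θ² ≤ ∫ V|Φ|²` (`lintegral_interaction_theta_le`).

This is the convexity inequality for gradients (Lieb–Loss, *Analysis*, Thm 7.8) for the continuous
family `{Φ(· - t𝟙ₐ)}_t`; folklore.
-/

noncomputable section

open MeasureTheory Filter Set
open scoped ENNReal NNReal Topology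

namespace Summit.AtomisticToContinuum.BoseEinsteinCondensation.Theorems.RigidMomentumBound

open Literature.MathematicalPhysics.QuantumManyBody.BoseGas

namespace SmearStep

variable {N : ℕ} {L₀ : ℝ}

section derivBounds

variable (Φ : TrialState N L₀) (a : Fin 3) {τ : ℝ} (hτ : 0 < τ)
  {w u w' : ℝ → ℝ} (hw0 : ∀ t, 0 ≤ w t) (hu0 : ∀ t, 0 ≤ u t)
  (hwc : Continuous w) (huc : Continuous u)
  (habs : ∀ t, |w' t| = Real.sqrt (w t) * Real.sqrt (u t))
  {F : Config N → ℝ}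
  (hF : F = fun X => ∫ t in (0 : ℝ)..(2 * τ),
    ‖Φ.ψ (X - t • (fun _ : Fin N => EuclideanSpace.single a (1 : ℝ)))‖ ^ 2 * w t)
  (hFdiff : ContDiff ℝ 1 F)
  (hFderiv : ∀ X Y : Config N, fderiv ℝ F X Y = ∫ t in (0 : ℝ)..(2 * τ),
    fderiv ℝ (fun Z : Config N => ‖Φ.ψ Z‖ ^ 2)
      (X - t • (fun _ : Fin N => EuclideanSpace.single a (1 : ℝ))) Y * w t)
  (hFrigid : ∀ X : Config N, fderiv ℝ F X (fun _ : Fin N => EuclideanSpace.single a (1 : ℝ)) =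
    ∫ t in (0 : ℝ)..(2 * τ),
      ‖Φ.ψ (X - t • (fun _ : Fin N => EuclideanSpace.single a (1 : ℝ)))‖ ^ 2 * w' t)

/-- Bookkeeping: `ofReal (√r)² = ofReal r` (registered sub-goal anchoring this helper file on the crux
item). [folklore] -/
theorem ofReal_sqrt_sq : ∀ {r : ℝ}, 0 ≤ r → ENNReal.ofReal (Real.sqrt r) ^ 2 = ENNReal.ofReal r := by
  intro r hr
  rw [← ENNReal.ofReal_pow (Real.sqrt_nonneg _), Real.sq_sqrt hr]

include hτ hw0 hwc hF hFderiv in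
/-- **Cauchy–Schwarz for `DF`**: `(DF(X)Y)² ≤ 4 F(X) ∫_{(0,2τ]} |DΦ(X - t𝟙ₐ) Y|² w(t) dt` in `ℝ≥0∞`.
[folklore] -/
theorem sq_fderiv_F_le (X Y : Config N) :
    ENNReal.ofReal ((fderiv ℝ F X Y) ^ 2) ≤ 2 ^ 2 * (ENNReal.ofReal (F X) *
      ∫⁻ t in Ioc (0 : ℝ) (2 * τ),
        ((‖fderiv ℝ Φ.ψ (X - t • (fun _ : Fin N => EuclideanSpace.single a (1 : ℝ))) Y‖₊ : ℝ≥0∞)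
          ^ 2) * ENNReal.ofReal (w t)) := by
  have hdiff : Differentiable ℝ Φ.ψ := Φ.contDiff.differentiable one_ne_zero
  set D : Config N := fun _ : Fin N => EuclideanSpace.single a (1 : ℝ) with hD
  rw [hFderiv, intervalIntegral.integral_of_le (by linarith), ofReal_F_eq Φ a hτ hw0 hwc hF X]
  -- Cauchy–Schwarz with `p = |Φ_t| √w`, `q = |DΦ_t Y| √w`, `c = 2`
  have hp : Measurable fun t : ℝ =>
      ((‖Φ.ψ (X - t • D)‖₊ : ℝ≥0∞)) * ENNReal.ofReal (Real.sqrt (w t)) :=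
    ((Φ.contDiff.continuous.comp (continuous_const.sub (continuous_id.smul continuous_const)))
      |>.measurable.nnnorm.coe_nnreal_ennreal).mul
      (ENNReal.measurable_ofReal.comp (Real.continuous_sqrt.measurable.comp hwc.measurable))
  have hq : Measurable fun t : ℝ =>
      ((‖fderiv ℝ Φ.ψ (X - t • D) Y‖₊ : ℝ≥0∞)) * ENNReal.ofReal (Real.sqrt (w t)) := by
    refine Measurable.mul ?_
      (ENNReal.measurable_ofReal.comp (Real.continuous_sqrt.measurable.comp hwc.measurable))
    have hc : Continuous fun t : ℝ => fderiv ℝ Φ.ψ (X - t • D) Y :=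
      ((Φ.contDiff.continuous_fderiv one_ne_zero).comp
        (continuous_const.sub (continuous_id.smul continuous_const))).clm_apply continuous_const
    exact hc.measurable.nnnorm.coe_nnreal_ennreal
  have hCS := ofReal_sq_integral_le (S := Ioc (0 : ℝ) (2 * τ))
    (φ := fun t => fderiv ℝ (fun Z : Config N => ‖Φ.ψ Z‖ ^ 2) (X - t • D) Y * w t) hp hq 2
    (fun t _ => by
      rw [Real.enorm_eq_ofReal_abs, abs_mul, abs_of_nonneg (hw0 t)]
      have h1 := abs_fderiv_norm_sq_le (hdiff (X - t • D)) Y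
      calc ENNReal.ofReal (|fderiv ℝ (fun Z : Config N => ‖Φ.ψ Z‖ ^ 2) (X - t • D) Y| * w t)
          ≤ ENNReal.ofReal (2 * ‖Φ.ψ (X - t • D)‖ * ‖fderiv ℝ Φ.ψ (X - t • D) Y‖ * w t) :=
            ENNReal.ofReal_le_ofReal (mul_le_mul_of_nonneg_right h1 (hw0 t))
        _ = 2 * (((‖Φ.ψ (X - t • D)‖₊ : ℝ≥0∞)) * ENNReal.ofReal (Real.sqrt (w t))) *
              (((‖fderiv ℝ Φ.ψ (X - t • D) Y‖₊ : ℝ≥0∞)) * ENNReal.ofReal (Real.sqrt (w t))) := by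
            rw [ENNReal.ofReal_mul (by positivity), ENNReal.ofReal_mul (by positivity),
              ENNReal.ofReal_mul (by norm_num), ENNReal.ofReal_ofNat, ofReal_norm, ofReal_norm,
              enorm_eq_nnnorm, enorm_eq_nnnorm]
            conv_lhs => rw [← Real.mul_self_sqrt (hw0 t)]
            rw [ENNReal.ofReal_mul (Real.sqrt_nonneg _)]
            ring)
  refine hCS.trans (le_of_eq ?_)
  congr 2
  · refine lintegral_congr fun t => ?_
    rw [mul_pow, ofReal_sqrt_sq (hw0 t)]
  · refine lintegral_congr fun t => ?_
    rw [mul_pow, ofReal_sqrt_sq (hw0 t)]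

include hτ hw0 hu0 hwc huc habs hF hFrigid in
/-- **Cauchy–Schwarz for the rigid derivative** (after the integration by parts encoded in (H2.iii)):
`(DF(X)𝟙ₐ)² ≤ F(X) ∫_{(0,2τ]} |Φ(X - t𝟙ₐ)|² u(t) dt` in `ℝ≥0∞`. [folklore] -/
theorem sq_fderiv_F_rigid_le (X : Config N) :
    ENNReal.ofReal ((fderiv ℝ F X (fun _ : Fin N => EuclideanSpace.single a (1 : ℝ))) ^ 2) ≤
      1 ^ 2 * (ENNReal.ofReal (F X) *
        ∫⁻ t in Ioc (0 : ℝ) (2 * τ),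
          ((‖Φ.ψ (X - t • (fun _ : Fin N => EuclideanSpace.single a (1 : ℝ)))‖₊ : ℝ≥0∞) ^ 2) *
            ENNReal.ofReal (u t)) := by
  set D : Config N := fun _ : Fin N => EuclideanSpace.single a (1 : ℝ) with hD
  rw [hFrigid, intervalIntegral.integral_of_le (by linarith), ofReal_F_eq Φ a hτ hw0 hwc hF X]
  have hcont : Continuous fun t : ℝ => Φ.ψ (X - t • D) :=
    Φ.contDiff.continuous.comp (continuous_const.sub (continuous_id.smul continuous_const))
  have hp : Measurable fun t : ℝ =>
      ((‖Φ.ψ (X - t • D)‖₊ : ℝ≥0∞)) * ENNReal.ofReal (Real.sqrt (w t)) :=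
    (hcont.measurable.nnnorm.coe_nnreal_ennreal).mul
      (ENNReal.measurable_ofReal.comp (Real.continuous_sqrt.measurable.comp hwc.measurable))
  have hq : Measurable fun t : ℝ =>
      ((‖Φ.ψ (X - t • D)‖₊ : ℝ≥0∞)) * ENNReal.ofReal (Real.sqrt (u t)) :=
    (hcont.measurable.nnnorm.coe_nnreal_ennreal).mul
      (ENNReal.measurable_ofReal.comp (Real.continuous_sqrt.measurable.comp huc.measurable))
  have hCS := ofReal_sq_integral_le (S := Ioc (0 : ℝ) (2 * τ))
    (φ := fun t => ‖Φ.ψ (X - t • D)‖ ^ 2 * w' t) hp hq 1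
    (fun t _ => by
      rw [Real.enorm_eq_ofReal_abs, abs_mul, abs_of_nonneg (sq_nonneg _), habs t, one_mul]
      rw [show ‖Φ.ψ (X - t • D)‖ ^ 2 * (Real.sqrt (w t) * Real.sqrt (u t)) =
          (‖Φ.ψ (X - t • D)‖ * Real.sqrt (w t)) * (‖Φ.ψ (X - t • D)‖ * Real.sqrt (u t)) by ring,
        ENNReal.ofReal_mul (by positivity), ENNReal.ofReal_mul (norm_nonneg _),
        ENNReal.ofReal_mul (norm_nonneg _), ofReal_norm, enorm_eq_nnnorm])
  refine hCS.trans (le_of_eq ?_)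
  congr 2
  · refine lintegral_congr fun t => ?_
    rw [mul_pow, ofReal_sqrt_sq (hw0 t)]
  · refine lintegral_congr fun t => ?_
    rw [mul_pow, ofReal_sqrt_sq (hu0 t)]

/-! ### The bounds for `θ = √(η² + F) - η` -/

include hτ hw0 hF hFdiff in
/-- The derivative of `θ`. [folklore] -/
theorem fderiv_theta {η : ℝ} (hη : 0 < η) (X : Config N) :
    fderiv ℝ (fun Z => Real.sqrt (η ^ 2 + F Z) - η) X =
      (1 / (2 * Real.sqrt (η ^ 2 + F X))) • fderiv ℝ F X := by
  have hpos : 0 < η ^ 2 + F X := by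
    have := F_nonneg Φ a hτ hw0 hF X
    positivity
  exact (hasFDerivAt_sqrtShift ((hFdiff.differentiable one_ne_zero) X).hasFDerivAt hpos).fderiv

include hτ hw0 hF hFdiff in
/-- `θ` is `C¹`. [folklore] -/
theorem contDiff_theta {η : ℝ} (hη : 0 < η) : ContDiff ℝ 1 fun Z => Real.sqrt (η ^ 2 + F Z) - η := by
  refine ContDiff.sub ?_ contDiff_const
  refine (contDiff_const.add hFdiff).sqrt fun X => ?_
  have := F_nonneg Φ a hτ hw0 hF X
  positivity

include hτ hw0 hwc hF hFdiff hFderiv in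
/-- **`(Dθ(X)Y)² ≤ ∫_{(0,2τ]} |DΦ(X - t𝟙ₐ)Y|² w`**, pointwise in `ℝ≥0∞`. [folklore] -/
theorem sq_fderiv_theta_le {η : ℝ} (hη : 0 < η) (X Y : Config N) :
    ENNReal.ofReal ((fderiv ℝ (fun Z => Real.sqrt (η ^ 2 + F Z) - η) X Y) ^ 2) ≤
      ∫⁻ t in Ioc (0 : ℝ) (2 * τ),
        ((‖fderiv ℝ Φ.ψ (X - t • (fun _ : Fin N => EuclideanSpace.single a (1 : ℝ))) Y‖₊ : ℝ≥0∞)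
          ^ 2) * ENNReal.ofReal (w t) := by
  set G := ∫⁻ t in Ioc (0 : ℝ) (2 * τ),
        ((‖fderiv ℝ Φ.ψ (X - t • (fun _ : Fin N => EuclideanSpace.single a (1 : ℝ))) Y‖₊ : ℝ≥0∞)
          ^ 2) * ENNReal.ofReal (w t) with hG
  rcases eq_or_ne G ⊤ with htop | htop
  · rw [htop]; exact le_top
  have hFX : 0 ≤ F X := F_nonneg Φ a hτ hw0 hF X
  have h1 := sq_fderiv_F_le Φ a hτ hw0 hwc hF hFderiv X Y
  rw [← hG, ← ENNReal.ofReal_toReal htop, ← ENNReal.ofReal_mul hFX,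
    show (2 : ℝ≥0∞) ^ 2 = ENNReal.ofReal 4 by norm_num, ← ENNReal.ofReal_mul (by norm_num),
    ENNReal.ofReal_le_ofReal_iff (by positivity)] at h1
  rw [fderiv_theta Φ a hτ hw0 hF hFdiff hη X, FunLike.coe_smul, Pi.smul_apply, smul_eq_mul,
    ← ENNReal.ofReal_toReal htop]
  refine ENNReal.ofReal_le_ofReal ?_
  exact sq_smul_deriv_le hFX ENNReal.toReal_nonneg hη (by linarith)

include hτ hw0 hu0 hwc huc habs hF hFdiff hFrigid in
/-- **`(Dθ(X)𝟙ₐ)² ≤ ¼ ∫_{(0,2τ]} |Φ(X - t𝟙ₐ)|² u`**, pointwise in `ℝ≥0∞`. [folklore] -/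
theorem sq_fderiv_theta_rigid_le {η : ℝ} (hη : 0 < η) (X : Config N) :
    ENNReal.ofReal ((fderiv ℝ (fun Z => Real.sqrt (η ^ 2 + F Z) - η) X
        (fun _ : Fin N => EuclideanSpace.single a (1 : ℝ))) ^ 2) ≤
      4⁻¹ * ∫⁻ t in Ioc (0 : ℝ) (2 * τ),
        ((‖Φ.ψ (X - t • (fun _ : Fin N => EuclideanSpace.single a (1 : ℝ)))‖₊ : ℝ≥0∞) ^ 2) *
          ENNReal.ofReal (u t) := by
  set U := ∫⁻ t in Ioc (0 : ℝ) (2 * τ),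
        ((‖Φ.ψ (X - t • (fun _ : Fin N => EuclideanSpace.single a (1 : ℝ)))‖₊ : ℝ≥0∞) ^ 2) *
          ENNReal.ofReal (u t) with hU
  rcases eq_or_ne U ⊤ with htop | htop
  · rw [htop, ENNReal.mul_top (by norm_num)]; exact le_top
  have hFX : 0 ≤ F X := F_nonneg Φ a hτ hw0 hF X
  have h1 := sq_fderiv_F_rigid_le Φ a hτ hw0 hu0 hwc huc habs hF hFrigid X
  rw [← hU, one_pow, one_mul, ← ENNReal.ofReal_toReal htop, ← ENNReal.ofReal_mul hFX,
    ENNReal.ofReal_le_ofReal_iff (by positivity)] at h1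
  rw [fderiv_theta Φ a hτ hw0 hF hFdiff hη X, FunLike.coe_smul, Pi.smul_apply, smul_eq_mul,
    ← ENNReal.ofReal_toReal htop]
  have h2 := sq_smul_deriv_le_quarter hFX ENNReal.toReal_nonneg hη h1
  calc ENNReal.ofReal ((1 / (2 * Real.sqrt (η ^ 2 + F X)) *
        fderiv ℝ F X (fun _ : Fin N => EuclideanSpace.single a (1 : ℝ))) ^ 2)
      ≤ ENNReal.ofReal (U.toReal / 4) := ENNReal.ofReal_le_ofReal h2
    _ = 4⁻¹ * ENNReal.ofReal U.toReal := by
        rw [div_eq_inv_mul, ENNReal.ofReal_mul (by norm_num), ENNReal.ofReal_inv_of_pos (by norm_num),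
          ENNReal.ofReal_ofNat]

end derivBounds

end SmearStep

end Summit.AtomisticToContinuum.BoseEinsteinCondensation.Theorems.RigidMomentumBound

end
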